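import Summits.QuantumFields.BalabanUV.Beta.MultiscaleHessianL2
import Summits.QuantumFields.BalabanUV.Beta.MultiscaleGradientL2Adjoint

/-!
# `Summit.QuantumFields.BalabanUV.Beta.MultiscaleHessianL2Adjoint` — engine file 22g: THE PURE SECOND-ORDER ℓ² MEMBER (3.46)₆'s SHAPE
# for `levelOp` (FLAT transport, CONSTANT bond weight) — `‖1_{cell k}(levelOp)⁻¹∇*∇*Λ‖₂ ≤ K_H·E·‖Λ‖₂`, NO power of the scale — by
# TRANSPOSITION of file 22f's member (3.46)₄ (`levelOp` symmetric; `D* = Dᵀ`; the bond-difference `δ` of 22a's Hessian and its transpose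
# `δᵀ`); closes the programme «HESSIAN-L2-FLAT» (files 22a–22g)

HONEST FRAMING (page 1 of everything in this cell).  Discharging `FlowStep.BetaPertH` would make Bałaban's ultraviolet
stability UNCONDITIONAL — a constructive-QFT result; it is NOT the continuum limit and NOT the Clay problem.  This module
discharges nothing of `BetaPertH`; it is [folklore] finite-dimensional bookkeeping about the MODEL operator, kernel-checked, by the
OWNER of binder row D4 (unit `b2b-balaban-beta-an4`, gen 47).  HONEST DEPENDENCY: continuum YM on T⁴ ⇐ BetaPertH ∧ nine spine
estimates (0/9 proved); BetaPertH ⇐ (D1) ∧ (D4) ∧ CAP+tail; G-an2-4 gates asym, D1 and NE2/3/4.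

THE POINT (O.2 item (i), MODEL level; NOT the critical path).  [B9] Thm 3.1 (3.46)₆ p. 398: «‖hG′(U)∇*_U∇*_Uλ‖ ≤ B₀·1·|h|e^{−δ₀d(y,y′)}
‖λ‖» — the adjoint of (3.46)₄; p. 398 «we may always replace ∇_U by ∇*_U, and vice versa».  MODEL: the Hessian map of file 22f is
`Hess = δ ∘ D` with `(δF)(((x,μ),ν),i) = F((x+e_ν,μ),i) − F((x,μ),i)` on bond fields (`fdiffB`); its transpose is `D* ∘ δᵀ` with
`(δᵀΛ)((x,μ),i) = Σ_ν(Λ(((x−e_ν,μ),ν),i) − Λ(((x,μ),ν),i))` (`fdiffBT`, pairing `sum_fdiffBT_mul` by the torus translation `sum_up_eq`).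
Since `(levelOp)⁻¹` is symmetric (`isTransposePair_levelOp` + `isTransposePair_inv`) and `D* = Dᵀ` (`sum_covDT_mul`),
`⟨1_kF, F⟩ = ⟨Hess((levelOp)⁻¹(1_kF)), Λ⟩ ≤ ‖1_{k′}Hess((levelOp)⁻¹(1_kF))‖·‖Λ‖` for `F = (levelOp)⁻¹D*δᵀΛ` and `Λ` supported on cell
`k′`, and file 22f with source cell `k`, target cell `k′` (its decay factor `E` is symmetric in `k, k′`) gives
**`real_cellAdjHess_levelOp_inverse_le`**: `‖1_{cell k}(levelOp)⁻¹D*δᵀΛ‖₂ ≤ √(N_cnt·K_tot/c₀²)·E·‖1_{cell k′}Λ‖₂` — the pattern of file 20d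
one order up.  WHAT THIS IS NOT: nothing of Bałaban's G′(U)∇*_U∇*_U; flat transport only; row D4 readiness width 0; D4 DISCHARGE NO DATE.

WHAT IS CERTIFIED (kernel, 0 sorry; two `def`s `fdiffB`, `fdiffBT`): `sum_fdiffBT_mul`, `sum_cellHess_eq`,
**`real_cellAdjHess_levelOp_inverse_le`**.  LOCATORS (shape only; ABSOLUTE RULE — nothing printed is asserted):
[Balaban1985BackgroundPropagators] Thm 3.1 (3.46) p. 398 + remark p. 398, (3.8) p. 392.  NOT BetaPertH, NOT continuum, NOT Clay, NOT
summit progress.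
-/

open scoped BigOperators
open Finset

namespace Summit.QuantumFields.BalabanUV.Beta.MultiscaleHessianL2Adjoint

open Summit.QuantumFields.BalabanUV.Beta.MultiscaleHessianL2 (real_cellHess_levelOp_inverse_le)
open Summit.QuantumFields.BalabanUV.Beta.MultiscaleHessianIdentity (sum_up_eq)
open Summit.QuantumFields.BalabanUV.Beta.MultiscaleGradientL2Adjoint (sum_indicator_mul_self)
open Summit.QuantumFields.BalabanUV.Beta.BoxPoincare (Box)
open Summit.QuantumFields.BalabanUV.Beta.MultiscaleCoerciveTorus
open Summit.QuantumFields.BalabanUV.Beta.MultiscaleDistance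
open Summit.QuantumFields.BalabanUV.Beta.MultiscaleDistanceMetric (sdist_comm)
open Summit.QuantumFields.BalabanUV.Beta.MultiscaleDecayBudget
open Summit.QuantumFields.BalabanUV.Beta.MultiscaleDecay (decay_levelOp)
open Literature.MathematicalPhysics.QuantumFieldTheory.Balaban1983to89
open Literature.MathematicalPhysics.QuantumFieldTheory.Balaban1983to89.B9Thm37Glue (covD covDT sum_covDT_mul IsTransposePair)
open Literature.MathematicalPhysics.QuantumFieldTheory.Balaban1983to89.B9Thm37GluePU (bsrc btgt)
open Literature.MathematicalPhysics.QuantumFieldTheory.Balaban1983to89.B9Thm37GlueSz (isTransposePair_inv)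
open Literature.MathematicalPhysics.QuantumFieldTheory.Balaban1983to89.B9Thm37GlueTorusCov (tblk)
open Literature.MathematicalPhysics.QuantumFieldTheory.Balaban1983to89.B9Thm37GlueTorusCovLevels (levelOp isTransposePair_levelOp)
open B5TorusCover (UT Ctr ctrU)
open B5Leibniz121 (up dn up_dn)
open B5DirichletDg (dn_up)

noncomputable section

variable {d : ℕ} {N : Fin d → ℕ} [∀ i, NeZero (N i)]

/-! ## §1 The bond difference `δ` of the Hessian and its transpose -/

/-- `δ` on bond fields: `(δF)(((x,μ),ν),i) = F((x+e_ν,μ),i) − F((x,μ),i)` — so that `Hess = δ ∘ D`. [folklore] -/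
def fdiffB {Cp : Type} (F : (UT N × Fin d) × Cp → ℝ) : ((UT N × Fin d) × Fin d) × Cp → ℝ :=
  fun r => F ((up r.1.1.1 r.1.2, r.1.1.2), r.2) - F (r.1.1, r.2)

/-- `δᵀ`: `(δᵀΛ)((x,μ),i) = Σ_ν (Λ(((x−e_ν,μ),ν),i) − Λ(((x,μ),ν),i))`. [folklore] -/
def fdiffBT {Cp : Type} (Λ : ((UT N × Fin d) × Fin d) × Cp → ℝ) : (UT N × Fin d) × Cp → ℝ :=
  fun q => ∑ ν, (Λ (((dn q.1.1 ν, q.1.2), ν), q.2) - Λ ((q.1, ν), q.2))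

/-- **`δᵀ` is the transpose of `δ`**: `Σ_q (δᵀΛ)(q)·F(q) = Σ_r Λ(r)·(δF)(r)` (torus translation). [folklore] -/
theorem sum_fdiffBT_mul {Cp : Type} [Fintype Cp] (Λ : ((UT N × Fin d) × Fin d) × Cp → ℝ) (F : (UT N × Fin d) × Cp → ℝ) :
    ∑ q, fdiffBT Λ q * F q = ∑ r, Λ r * fdiffB F r := by
  -- both sides as iterated sums over `x, μ, ν, i`
  have hL : ∑ q, fdiffBT Λ q * F q =
      ∑ x : UT N, ∑ μ : Fin d, ∑ i : Cp, ∑ ν : Fin d, (Λ (((dn x ν, μ), ν), i) - Λ (((x, μ), ν), i)) * F ((x, μ), i) := by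
    rw [Fintype.sum_prod_type, Fintype.sum_prod_type]
    refine Finset.sum_congr rfl fun x _ => Finset.sum_congr rfl fun μ _ => Finset.sum_congr rfl fun i _ => ?_
    unfold fdiffBT
    rw [Finset.sum_mul]
  have hR : ∑ r, Λ r * fdiffB F r =
      ∑ x : UT N, ∑ μ : Fin d, ∑ ν : Fin d, ∑ i : Cp, Λ (((x, μ), ν), i) * (F ((up x ν, μ), i) - F ((x, μ), i)) := by
    rw [Fintype.sum_prod_type, Fintype.sum_prod_type, Fintype.sum_prod_type]
    rfl
  rw [hL, hR]
  -- swap `i` and `ν` on the left, then compare per `(μ, ν, i)` after summing over `x`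
  have hL2 : ∑ x : UT N, ∑ μ : Fin d, ∑ i : Cp, ∑ ν : Fin d, (Λ (((dn x ν, μ), ν), i) - Λ (((x, μ), ν), i)) * F ((x, μ), i) =
      ∑ x : UT N, ∑ μ : Fin d, ∑ ν : Fin d, ∑ i : Cp, (Λ (((dn x ν, μ), ν), i) - Λ (((x, μ), ν), i)) * F ((x, μ), i) :=
    Finset.sum_congr rfl fun x _ => Finset.sum_congr rfl fun μ _ => Finset.sum_comm
  rw [hL2, Finset.sum_comm]
  conv_rhs => rw [Finset.sum_comm]
  refine Finset.sum_congr rfl fun μ _ => ?_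
  rw [Finset.sum_comm]
  conv_rhs => rw [Finset.sum_comm]
  refine Finset.sum_congr rfl fun ν _ => ?_
  rw [Finset.sum_comm]
  conv_rhs => rw [Finset.sum_comm]
  refine Finset.sum_congr rfl fun i _ => ?_
  -- `Σ_x Λ(x−e_ν)F(x) = Σ_x Λ(x)F(x+e_ν)` by translation
  have ht : ∑ x : UT N, Λ (((dn x ν, μ), ν), i) * F ((x, μ), i) = ∑ x : UT N, Λ (((x, μ), ν), i) * F ((up x ν, μ), i) := by
    rw [← sum_up_eq (fun x => Λ (((dn x ν, μ), ν), i) * F ((x, μ), i)) ν]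
    exact Finset.sum_congr rfl fun x _ => by rw [dn_up]
  simp only [sub_mul, mul_sub, Finset.sum_sub_distrib, ht]

/-- The Hessian energy of a cell as a filtered sum over the `δ∘D` index type. [folklore] -/
theorem sum_cellHess_eq {Cp K : Type} [Fintype Cp] [DecidableEq K] (cellOf' : UT N → K) (k : K) (F : (UT N × Fin d) × Cp → ℝ) :
    ∑ r ∈ univ.filter (fun r : ((UT N × Fin d) × Fin d) × Cp => cellOf' r.1.1.1 = k), fdiffB F r ^ 2 =
      ∑ x ∈ univ.filter (fun x : UT N => cellOf' x = k), ∑ μ : Fin d, ∑ ν : Fin d, ∑ i : Cp,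
        (F ((up x ν, μ), i) - F ((x, μ), i)) ^ 2 := by
  classical
  have hprod : (univ.filter (fun r : ((UT N × Fin d) × Fin d) × Cp => cellOf' r.1.1.1 = k)) =
      (((univ.filter (fun x : UT N => cellOf' x = k)) ×ˢ (univ : Finset (Fin d))) ×ˢ (univ : Finset (Fin d))) ×ˢ
        (univ : Finset Cp) := by
    ext r
    simp only [mem_filter, mem_univ, true_and, mem_product, and_true]
  rw [hprod, Finset.sum_product, Finset.sum_product, Finset.sum_product]
  rfl

/-! ## §2 THE ADJOINT MEMBER (3.46)₆ by transposition of (3.46)₄ -/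

variable [NeZero d] {Cp J K : Type} [Fintype Cp] [DecidableEq Cp] [Nonempty Cp]
  [Fintype J] [Fintype K] [DecidableEq K] (S : J → ℕ) (hS : ∀ l, 1 ≤ S l) (hdivS : ∀ l i, S l ∣ N i) (lvl : K → J)
  (zc : (k : K) → Ctr N (S (lvl k)))
  (hdisj : ∀ k k' v v', cellPt S hS hdivS lvl zc k v = cellPt S hS hdivS lvl zc k' v' → k = k')
  (hcover : ∀ x : UT N, ∃ k, ∃ v : Box d (S (lvl k)), cellPt S hS hdivS lvl zc k v = x)
  (Rm : UT N × Fin d → Cp → Cp → ℝ) (hRm : ∀ b i j, ∑ k, Rm b k i * Rm b k j = if i = j then (1 : ℝ) else 0)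
  (T : J → UT N → Cp → Cp → ℝ) (hT : ∀ l x i i', ∑ k, T l x k i * T l x k i' = if i = i' then (1 : ℝ) else 0)
  (a : J → ℝ) (ha : ∀ j, 0 ≤ a j) (ω : J → UT N → ℝ)
  (hsupp : ∀ l x, ω l (ctrU N (S l) (tblk (hS l) (hdivS l) x)) ≠ 0 → ∃ k v, lvl k = l ∧ cellPt S hS hdivS lvl zc k v = x)
  {amax : ℝ} (hamax : 0 ≤ amax)
  (hscale : ∀ k, a (lvl k) * ω (lvl k) (ctrU N (S (lvl k)) (zc k)) ^ 2 * (S (lvl k) : ℝ) ^ d ≤ amax / (S (lvl k) : ℝ) ^ 2)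
  (c : UT N × Fin d → ℝ) {cmax : ℝ} (hc : ∀ b, |c b| ≤ cmax) {C : ℝ}
  (hcoer : ∀ f : UT N × Cp → ℝ,
    C * ∑ k, ((S (lvl k) : ℝ) ^ 2)⁻¹ * ∑ v : Box d (S (lvl k)), ∑ i, f (cellPt S hS hdivS lvl zc k v, i) ^ 2 ≤
      ∑ p, f p * levelOp bsrc btgt c Rm (fun l x => ctrU N (S l) (tblk (hS l) (hdivS l) x))
        (fun l x => ω l (ctrU N (S l) (tblk (hS l) (hdivS l) x))) T a f p)
  {κ : ℝ} (hκ0 : 0 ≤ κ) (hκ1 : κ ≤ 1) (hμ : 0 < C - 2 * d * cmax ^ 2 * κ ^ 2 - amax * (Real.exp (2 * d * κ) - 1))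
  {L : ℕ} (hL : 1 ≤ L) (e : J → ℕ) (hSe : ∀ l, S l = L ^ e l) {R : ℝ} (hR : 0 < R) {A : ℕ}
  (hadd : ∀ x y : UT N, |(e (lvl (cellOf S hS hdivS lvl zc hcover x)) : ℝ) - e (lvl (cellOf S hS hdivS lvl zc hcover y))| ≤
    A + sdist bsrc btgt (siteScale S hS hdivS lvl zc hcover) x y / R)
  (hrate1 : Real.log L / R ≤ κ)
  (hflat : ∀ b k i, Rm b k i = if k = i then 1 else 0) {c₀ : ℝ} (hcc : ∀ b, c b = c₀) (hc₀ : c₀ ≠ 0)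

include hdisj hRm hT ha hsupp hamax hscale hc hcoer hκ0 hκ1 hμ hL hSe hR hadd hrate1 hflat hcc hc₀

/-- **THE PURE SECOND-ORDER ℓ² MEMBER (3.46)₆'s SHAPE FOR `levelOp` — BY TRANSPOSITION OF (3.46)₄.**  Same setting and constants as
`MultiscaleHessianL2.real_cellHess_levelOp_inverse_le`; for a field `Λ` on the Hessian index type supported on cell `k′`
(`cellOf r.1.1.1 = k′`) and every cell `k`:
`√(Σ_{p ∈ cell k}((levelOp)⁻¹(D*(δᵀΛ)))(p)²) ≤ √(N_cnt·K_tot/c₀²)·e^{(κ−log L/R)(4d+ρ₀)}·e^{−(κ−log L/R)d_n(t_k,t_{k′})}·√(Σ_{cell k′}Λ²)`.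
[cite: Balaban1985BackgroundPropagators, Thm 3.1 (3.46) p.398 + p.398 «replace ∇_U by ∇*_U»] [folklore] -/
theorem real_cellAdjHess_levelOp_inverse_le (ρ₀ : ℕ) (hρ₀ : 8 * d * ((L : ℝ) ^ A * Real.exp (Real.log L / R * ρ₀)) ≤ ρ₀) {ε : ℝ}
    (hε : 0 < ε) (k' : K) (Λ : ((UT N × Fin d) × Fin d) × Cp → ℝ)
    (hΛ : ∀ r, cellOf S hS hdivS lvl zc hcover r.1.1.1 ≠ k' → Λ r = 0) (k : K) :
    Real.sqrt (∑ p ∈ univ.filter (fun p : UT N × Cp => cellOf S hS hdivS lvl zc hcover p.1 = k),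
        ((Ring.inverse (levelOp bsrc btgt c Rm (fun l x => ctrU N (S l) (tblk (hS l) (hdivS l) x))
          (fun l x => ω l (ctrU N (S l) (tblk (hS l) (hdivS l) x))) T a)) (covDT bsrc btgt c Rm (fdiffBT Λ)) p) ^ 2) ≤
      Real.sqrt ((3 * ((L : ℝ) ^ A) ^ 2) ^ d * ((d.factorial : ℝ) / ε ^ d) * Real.exp (2 * d * (ε + Real.log L / R * d)) *
            Real.exp (ε + 2 * (Real.log L / R) * d) ^ (4 * d + ρ₀ + 1) *
          (3 * (2 * (1 + Fintype.card Cp * amax ^ 2 * ((L : ℝ) ^ A * Real.exp (4 * d * κ) /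
              (C - 2 * d * cmax ^ 2 * κ ^ 2 - amax * (Real.exp (2 * d * κ) - 1))) ^ 2)) +
            12 * d ^ 2 * c₀ ^ 4 * ((L : ℝ) ^ A * Real.exp (4 * d * κ) *
              ((L : ℝ) ^ A * Real.exp (Real.log L / R * (4 * d + ρ₀))) ^ 2 /
              (C - 2 * d * cmax ^ 2 * κ ^ 2 - amax * (Real.exp (2 * d * κ) - 1))) ^ 2 +
            12 * d * c₀ ^ 2 * (Real.sqrt (2 * (C + d * Real.exp 1 ^ 2 * cmax ^ 2)) * (L : ℝ) ^ A *
              ((L : ℝ) ^ A * Real.exp (Real.log L / R * (4 * d + ρ₀))) /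
              (C - 2 * d * cmax ^ 2 * κ ^ 2 - amax * (Real.exp (2 * d * κ) - 1)) * Real.exp (4 * d * κ)) ^ 2) / c₀ ^ 2) *
        (Real.exp ((κ - Real.log L / R) * (4 * d + ρ₀)) *
          Real.exp (-((κ - Real.log L / R) * sdist bsrc btgt (siteScale S hS hdivS lvl zc hcover)
            (ctrU N (S (lvl k)) (zc k)) (ctrU N (S (lvl k')) (zc k'))))) *
        Real.sqrt (∑ r ∈ univ.filter (fun r : ((UT N × Fin d) × Fin d) × Cp => cellOf S hS hdivS lvl zc hcover r.1.1.1 = k'),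
          Λ r ^ 2) := by
  classical
  obtain ⟨i₀⟩ := ‹Nonempty Cp›
  -- file 22f with source cell `k` and target cell `k′`, for an arbitrary source field (instantiated below)
  have h22f := real_cellHess_levelOp_inverse_le S hS hdivS lvl zc hdisj hcover Rm hRm T hT a ha ω hsupp hamax hscale c hc hcoer hκ0 hκ1
    hμ hL e hSe hR hadd hrate1 hflat hcc hc₀ ρ₀ hρ₀ hε k
  set μ₀ := C - 2 * d * cmax ^ 2 * κ ^ 2 - amax * (Real.exp (2 * d * κ) - 1) with hμ₀
  set Aop := levelOp bsrc btgt c Rm (fun l x => ctrU N (S l) (tblk (hS l) (hdivS l) x))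
    (fun l x => ω l (ctrU N (S l) (tblk (hS l) (hdivS l) x))) T a with hAop
  set n := siteScale S hS hdivS lvl zc hcover with hn
  set tk : UT N := ctrU N (S (lvl k)) (zc k) with htk
  set tk' : UT N := ctrU N (S (lvl k')) (zc k') with htk'
  set F := (Ring.inverse Aop) (covDT bsrc btgt c Rm (fdiffBT Λ)) with hF
  set P := univ.filter (fun p : UT N × Cp => cellOf S hS hdivS lvl zc hcover p.1 = k) with hP
  set h : UT N × Cp → ℝ := fun p => if p ∈ P then F p else 0 with hh
  set KH : ℝ := Real.sqrt ((3 * ((L : ℝ) ^ A) ^ 2) ^ d * ((d.factorial : ℝ) / ε ^ d) * Real.exp (2 * d * (ε + Real.log L / R * d)) *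
        Real.exp (ε + 2 * (Real.log L / R) * d) ^ (4 * d + ρ₀ + 1) *
      (3 * (2 * (1 + Fintype.card Cp * amax ^ 2 * ((L : ℝ) ^ A * Real.exp (4 * d * κ) / μ₀) ^ 2)) +
        12 * d ^ 2 * c₀ ^ 4 * ((L : ℝ) ^ A * Real.exp (4 * d * κ) *
          ((L : ℝ) ^ A * Real.exp (Real.log L / R * (4 * d + ρ₀))) ^ 2 / μ₀) ^ 2 +
        12 * d * c₀ ^ 2 * (Real.sqrt (2 * (C + d * Real.exp 1 ^ 2 * cmax ^ 2)) * (L : ℝ) ^ A *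
          ((L : ℝ) ^ A * Real.exp (Real.log L / R * (4 * d + ρ₀))) / μ₀ * Real.exp (4 * d * κ)) ^ 2) / c₀ ^ 2) with hKH
  set E : ℝ := Real.exp ((κ - Real.log L / R) * (4 * d + ρ₀)) * Real.exp (-((κ - Real.log L / R) * sdist bsrc btgt n tk tk'))
    with hE
  have hKH0 : 0 ≤ KH := Real.sqrt_nonneg _
  have hE0 : 0 ≤ E := by positivity
  clear_value KH
  -- units and symmetry
  have hunit : IsUnit Aop :=
    (decay_levelOp S hS hdivS lvl zc hdisj hcover Rm hRm T hT a ha ω hsupp hamax hscale c hc hcoer hκ0 hκ1 hμ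
      (tk', i₀) (tk', i₀)).1
  have hmul : Aop * Ring.inverse Aop = 1 := Ring.mul_inverse_cancel _ hunit
  have hsymA : IsTransposePair Aop Aop := by
    rw [hAop]; exact isTransposePair_levelOp bsrc btgt c Rm _ _ T a
  have hsym : IsTransposePair (Ring.inverse Aop) (Ring.inverse Aop) := isTransposePair_inv hsymA hmul hmul
  -- `h` is supported in cell `k`
  have hhsupp : ∀ p, cellOf S hS hdivS lvl zc hcover p.1 ≠ k → h p = 0 := by
    intro p hp
    have hnot : p ∉ P := by rw [hP, mem_filter]; exact fun hmem => hp hmem.2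
    show (if p ∈ P then F p else 0) = 0
    rw [if_neg hnot]
  -- the duality chain `Σ_P F² = ⟨h, A⁻¹D*δᵀΛ⟩ = ⟨A⁻¹h, D*δᵀΛ⟩ = ⟨D A⁻¹h, δᵀΛ⟩ = ⟨δ D A⁻¹h, Λ⟩`
  set LHS2 : ℝ := ∑ p ∈ P, F p ^ 2 with hLHS2
  have hLHS0 : 0 ≤ LHS2 := Finset.sum_nonneg fun p _ => sq_nonneg _
  set G := fdiffB (covD bsrc btgt c Rm ((Ring.inverse Aop) h)) with hG
  have hdual : LHS2 = ∑ r, Λ r * G r := by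
    calc LHS2 = ∑ p, h p * F p := by rw [hLHS2, hh]; exact (sum_indicator_mul_self P F).symm
      _ = ∑ p, (Ring.inverse Aop) (covDT bsrc btgt c Rm (fdiffBT Λ)) p * h p := by
          rw [hF]; exact Finset.sum_congr rfl fun p _ => mul_comm _ _
      _ = ∑ p, covDT bsrc btgt c Rm (fdiffBT Λ) p * (Ring.inverse Aop) h p := hsym _ _
      _ = ∑ q, fdiffBT Λ q * covD bsrc btgt c Rm ((Ring.inverse Aop) h) q := sum_covDT_mul bsrc btgt c Rm (fdiffBT Λ) _
      _ = ∑ r, Λ r * G r := by rw [hG]; exact sum_fdiffBT_mul Λ _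
  -- restrict to the support of `Λ` and apply Cauchy–Schwarz
  set RC := univ.filter (fun r : ((UT N × Fin d) × Fin d) × Cp => cellOf S hS hdivS lvl zc hcover r.1.1.1 = k') with hRC
  have hrestr : ∑ r, Λ r * G r = ∑ r ∈ RC, Λ r * G r := by
    symm
    refine Finset.sum_subset (Finset.subset_univ RC) fun r _ hr => ?_
    have : Λ r = 0 := hΛ r (fun hmem => hr (by rw [hRC, mem_filter]; exact ⟨mem_univ _, hmem⟩))
    rw [this, zero_mul]
  set Lam2 : ℝ := ∑ r ∈ RC, Λ r ^ 2 with hLam2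
  set G2 : ℝ := ∑ r ∈ RC, G r ^ 2 with hG2
  have hLam0 : 0 ≤ Lam2 := Finset.sum_nonneg fun r _ => sq_nonneg _
  have hcs : ∑ r ∈ RC, Λ r * G r ≤ Real.sqrt Lam2 * Real.sqrt G2 := by
    have hcs0 := Real.sum_mul_le_sqrt_mul_sqrt RC Λ G
    rw [hLam2, hG2]; exact hcs0
  -- file 22f at the source field `h` (cell `k`) and the target cell `k′`
  have hmem := h22f h hhsupp k'
  have hG2eq : G2 = ∑ x ∈ univ.filter (fun x : UT N => cellOf S hS hdivS lvl zc hcover x = k'), ∑ μ : Fin d, ∑ ν : Fin d, ∑ i : Cp,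
      (covD bsrc btgt c Rm ((Ring.inverse Aop) h) ((up x ν, μ), i) - covD bsrc btgt c Rm ((Ring.inverse Aop) h) ((x, μ), i)) ^ 2 := by
    rw [hG2, hRC, hG]; exact sum_cellHess_eq _ k' _
  have hhnorm : ∑ q ∈ univ.filter (fun q : UT N × Cp => cellOf S hS hdivS lvl zc hcover q.1 = k), h q ^ 2 = LHS2 := by
    rw [← hP, hLHS2]
    refine Finset.sum_congr rfl fun p hp => ?_
    rw [hh]; simp only; rw [if_pos hp]
  have hdsym : sdist bsrc btgt n tk' tk = sdist bsrc btgt n tk tk' := sdist_comm bsrc btgt n tk' tk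
  have hbound : Real.sqrt G2 ≤ KH * E * Real.sqrt LHS2 := by
    rw [hG2eq, hE, ← hdsym, ← hhnorm]
    simpa only [hAop, hμ₀, hn, htk, htk'] using hmem
  -- assemble
  have hmain : LHS2 ≤ Real.sqrt LHS2 * (KH * E * Real.sqrt Lam2) := by
    calc LHS2 = ∑ r ∈ RC, Λ r * G r := by rw [hdual, hrestr]
      _ ≤ Real.sqrt Lam2 * Real.sqrt G2 := hcs
      _ ≤ Real.sqrt Lam2 * (KH * E * Real.sqrt LHS2) := mul_le_mul_of_nonneg_left hbound (Real.sqrt_nonneg _)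
      _ = Real.sqrt LHS2 * (KH * E * Real.sqrt Lam2) := by ring
  have hfin : Real.sqrt LHS2 ≤ KH * E * Real.sqrt Lam2 := by
    by_cases h0 : Real.sqrt LHS2 = 0
    · rw [h0]; positivity
    · have hpos : 0 < Real.sqrt LHS2 := lt_of_le_of_ne (Real.sqrt_nonneg _) (Ne.symm h0)
      have : Real.sqrt LHS2 * Real.sqrt LHS2 ≤ Real.sqrt LHS2 * (KH * E * Real.sqrt Lam2) := by
        rw [Real.mul_self_sqrt hLHS0]; exact hmain
      exact le_of_mul_le_mul_left this hpos
  simpa only [hE, hn, htk, htk', hLam2, hRC] using hfin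

end

end Summit.QuantumFields.BalabanUV.Beta.MultiscaleHessianL2Adjoint
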